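import Summits.KontsevichZagierPeriods.KontsevichZagierPeriods.Theorems.ComplexOrientationsOrientationKernelDimensionOneMerge

/-!
# Route ValuedFieldSpecialisation — crux `ParametricLifting` (stmt-KontsevichZagierPeriods-3498):
level 2 of the graded kernel conjecture is Conjecture 1 for pairs of dimension `≤ 1`

Helper (`--supports`) for item stmt-KontsevichZagierPeriods-3498 (line `registered`, lead c8, "graded
strata comparison: level 2 = Conjecture 1 for curves"). The graded reshape of the crux proves the kernel
statement level by level, level `E` being the subgroup
`AddSubgroup.closure {y | ∃ n (r : KZ.IntegralRep n), n < E ∧ y = KZ.of r}` of formal `ℤ`-combinations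
of integral representations of dimension `< E`. This file identifies LEVEL 2 — formal combinations of
constants and one-dimensional integrals `∫_σ f` (`σ ⊆ ℝ` `ℚ`-semialgebraic, `f` `ℚ`-semialgebraic),
i.e. of 1-periods — in KERNEL form with Kontsevich–Zagier's Conjecture 1 in PAIR form for
representations of dimension `≤ 1`:

* `exists_pair_of_mem_closure_dimLT_two` — every element of level 2 is `≡ [a] − [b]` modulo
  `KZ.relations` with `a b : KZ.IntegralRep 1` (constants are raised to dimension one by a slab,
  `KZ.IntegralRep.exists_equivalent_of_le`; sums merge inside dimension one by
  `ComplexOrientations.OrientationKernel.exists_add_sub_mem_relations_one`; `[∅] ∈ KZ.relations`);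
* `stub_kernelLevelTwo_iff_dimLeOnePairs` — `(∀ x ∈ level 2, KZ.eval x = 0 → x ∈ KZ.relations) ↔
  (∀ r r' of dimensions ≤ 1, r.value = r'.value → KZ.Equivalent r r')`.

Pure move bookkeeping plus soundness of the calculus (`KZ.relations_le_ker_eval_holds`); no
transcendence input. It identifies rung 2 of this route's graded open core with the dimension-one
items of routes LowDimension / DessinsDimensionOne.

Source: M. Kontsevich, D. Zagier, *Periods* (2001), §1.2, Conjecture 1 and rules (1)–(3).
-/

noncomputable section

namespace Summit.KontsevichZagierPeriods.ValuedFieldSpecialisation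

open Literature.NumberTheory.Transcendental
open Summit.KontsevichZagierPeriods.ComplexOrientations.OrientationKernel
  (exists_add_sub_mem_relations_one)

/-- **Pair normal form on level 2.** Every element of the subgroup of `KZ.FormalRep` generated by the
classes of representations of dimension `< 2` is congruent modulo `KZ.relations` to a difference
`[a] − [b]` of two ONE-dimensional classes: a generator `[r]` (`dim r ≤ 1`) is `≡ [R] − [∅]` with `R`
one-dimensional (`KZ.IntegralRep.exists_equivalent_of_le`, a slab and one Newton–Leibniz move when
`dim r = 0`; `[∅] ∈ KZ.relations`), `0 ≡ [∅] − [∅]`, negation swaps, and sums merge inside dimension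
one (`exists_add_sub_mem_relations_one`). [cite: KontsevichZagier2001, §1.2 Conjecture 1] -/
theorem exists_pair_of_mem_closure_dimLT_two {x : KZ.FormalRep}
    (hx : x ∈ AddSubgroup.closure
      {y : KZ.FormalRep | ∃ (n : ℕ) (r : KZ.IntegralRep n), n < 2 ∧ y = KZ.of r}) :
    ∃ a b : KZ.IntegralRep 1, x - (KZ.of a - KZ.of b) ∈ KZ.relations := by
  induction hx using AddSubgroup.closure_induction with
  | mem y hy =>
    obtain ⟨n, r, hn, rfl⟩ := hy
    obtain ⟨R, hR⟩ := KZ.IntegralRep.exists_equivalent_of_le r (show n ≤ 1 by omega)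
    refine ⟨R, KZ.IntegralRep.empty 1, ?_⟩
    have : KZ.of r - (KZ.of R - KZ.of (KZ.IntegralRep.empty 1)) =
        (KZ.of r - KZ.of R) + KZ.of (KZ.IntegralRep.empty 1) := by
      abel
    rw [this]
    exact KZ.relations.add_mem hR KZ.IntegralRep.of_empty_mem_relations
  | zero =>
    exact ⟨KZ.IntegralRep.empty 1, KZ.IntegralRep.empty 1, by simp⟩
  | add y z _ _ hy hz =>
    obtain ⟨a₁, b₁, e₁⟩ := hy
    obtain ⟨a₂, b₂, e₂⟩ := hz
    obtain ⟨a, ea⟩ := exists_add_sub_mem_relations_one a₁ a₂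
    obtain ⟨b, eb⟩ := exists_add_sub_mem_relations_one b₁ b₂
    refine ⟨a, b, ?_⟩
    have : y + z - (KZ.of a - KZ.of b) = (y - (KZ.of a₁ - KZ.of b₁)) + (z - (KZ.of a₂ - KZ.of b₂)) +
        (KZ.of a₁ + KZ.of a₂ - KZ.of a) - (KZ.of b₁ + KZ.of b₂ - KZ.of b) := by
      abel
    rw [this]
    exact KZ.relations.sub_mem (KZ.relations.add_mem (KZ.relations.add_mem e₁ e₂) ea) eb
  | neg y _ hy =>
    obtain ⟨a, b, e⟩ := hy
    refine ⟨b, a, ?_⟩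
    have : -y - (KZ.of b - KZ.of a) = -(y - (KZ.of a - KZ.of b)) := by abel
    rw [this]
    exact KZ.relations.neg_mem e

/-- **Level 2 of the graded kernel conjecture is Conjecture 1 for pairs of dimension `≤ 1`.** The
kernel statement on level 2 — every formal `ℤ`-combination of classes of representations of dimension
`< 2` with value `0` lies in `KZ.relations` — is equivalent to the pair statement: any two
representations of dimensions `≤ 1` with the same value are `KZ.Equivalent`. (→): `[r] − [r']` lies
on level 2 and evaluates to `r.value − r'.value = 0`. (←): put `x` in pair normal form
`x ≡ [a] − [b]` (`exists_pair_of_mem_closure_dimLT_two`); soundness (`KZ.relations_le_ker_eval_holds`)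
and `KZ.eval x = 0` give `a.value = b.value`, so `[a] − [b] ∈ KZ.relations` by the pair statement, and
`x = (x − ([a] − [b])) + ([a] − [b])`. [cite: KontsevichZagier2001, §1.2 Conjecture 1] -/
theorem stub_kernelLevelTwo_iff_dimLeOnePairs : (∀ (x : KZ.FormalRep), x ∈ AddSubgroup.closure {y : KZ.FormalRep | ∃ (n : ℕ) (r : KZ.IntegralRep n), n < 2 ∧ y = KZ.of r} → KZ.eval x = 0 → x ∈ KZ.relations) ↔ ∀ ⦃n m : ℕ⦄, n ≤ 1 → m ≤ 1 → ∀ (r : KZ.IntegralRep n) (r' : KZ.IntegralRep m), r.value = r'.value → KZ.Equivalent r r' := by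
  constructor
  · intro hK n m hn hm r r' hv
    show KZ.of r - KZ.of r' ∈ KZ.relations
    refine hK _ (AddSubgroup.sub_mem _ (AddSubgroup.subset_closure ⟨n, r, by omega, rfl⟩)
      (AddSubgroup.subset_closure ⟨m, r', by omega, rfl⟩)) ?_
    rw [map_sub, KZ.eval_of, KZ.eval_of, hv, sub_self]
  · intro hP x hx hx0
    obtain ⟨a, b, e⟩ := exists_pair_of_mem_closure_dimLT_two hx
    have hab : a.value = b.value := by
      have h : KZ.eval (x - (KZ.of a - KZ.of b)) = 0 :=
        AddMonoidHom.mem_ker.mp (KZ.relations_le_ker_eval_holds e)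
      rw [map_sub, map_sub, KZ.eval_of, KZ.eval_of, hx0] at h
      linarith
    have hpair : KZ.of a - KZ.of b ∈ KZ.relations := hP le_rfl le_rfl a b hab
    have : x = (x - (KZ.of a - KZ.of b)) + (KZ.of a - KZ.of b) := by abel
    rw [this]
    exact KZ.relations.add_mem e hpair

end Summit.KontsevichZagierPeriods.ValuedFieldSpecialisation

end
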